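import Literature.MathematicalPhysics.QuantumFieldTheory.Balaban1983to89.Beta.LogDetHessian
import Literature.MathematicalPhysics.QuantumFieldTheory.Balaban1983to89.Beta.CompositionSingular

/-!
# `BalabanUV.Beta.KKTInverseRegularity` — binder row D1, route (O3), work item K-U2f: **ENTRIES OF THE INVERSE OF A `C^k` MATRIX FIELD ARE `C^k`
# AT A NONSINGULAR POINT; HENCE THE BLOCKS `flucCov ∕ minOp ∕ minOpL ∕ effForm` OF THE BORDERED INVERSE ARE `C^k` IN THE BACKGROUND**
# (β sub-cell, BINDER-OWNERS row D1 OWNER, lineage an2 gen 23; discharges the smoothness side conditions of K-U2e `PolarizationTelescopingCompSlice`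
# from primitive data)

HONEST FRAMING (cell charter, verbatim): «discharging BetaPertH makes Balaban's UV stability UNCONDITIONAL — a real
constructive-QFT result; it is NOT the continuum limit and NOT the Clay problem.»
HONEST DEPENDENCY: continuum YM on T⁴ ⇐ BetaPertH ∧ nine spine estimates (0/9 proved); BetaPertH ⇐ (D1) ∧ (D4) ∧ CAP+tail;
G-an2-4 gates asym, D1 and NE2/3/4.
ABSOLUTE RULE (cell, verbatim): «No internally-minted statement may enter as a cited fact. Every hypothesis is either kernel-proved in this
package or a verbatim quotation of a PUBLISHED theorem with page reference. The manuscript(s) under audit are NOT citable for their own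
disputed steps — they are the thing under adjudication; programme-internal (2001/route/tribunal) claims are never citable.»
NOTHING below is cited: no `[cite: …]`, no `def`, no `Prop` fact.  Every declaration is [folklore] finite-dimensional calculus (Mathlib `contDiffAt_ringInverse`
in the complete normed algebra `Matrix p p ℝ` with the scoped `L^∞` operator norm, exactly as in pv09∕an2's `LogDetHessian` Part 1 — the norm appears in NO
exported statement: all conclusions are ENTRYWISE) over `LogDetHessian.contDiffAt_matrix` ∕ `entryCLM` and `CompositionSingular.flucCov ∕ minOp ∕ minOpL ∕
effForm` BY NAME.  It asserts nothing about Bałaban's objects.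

WHY (row-D1 owner, gen 23; `ROUTE-O3.md` §3, K-U2e's displayed hypotheses).  K-U2e (`PolarizationTelescopingCompSlice`) telescopes the one-loop polarizations
of the composed-slice two-level matrix model GIVEN that the fine and STEP functionals are `C²` at the base point; the step family's form is the physical
corner `(effForm K [Q₁;τ₁]).toBlocks₁₁` of an INVERSE of a bordered matrix, so its `C²` regularity in the background is «entries of the inverse of a `C²`
nonsingular matrix field are `C²`» — THIS FILE — after which `FamilyRegularity.Family.contDiffAt_logZ` applies.  With it, the only non-primitive hypothesis
left in K-U2e is (h-U): the step minimiser as a `C²` map (W-2, implicit-function data).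

WHAT (all [folklore]; `E` a real normed space of backgrounds, `p`, `ν`, `μ` finite index types):
§1 **`contDiffAt_inv_entry`**: `K : E → Matrix p p ℝ` with every entry `C^k` at `x₀` and `IsUnit (K x₀).det` ⟹ every entry of `x ↦ (K x)⁻¹` is `C^k` at `x₀`.
§2 **`contDiffAt_kkt_entry`** (entries of `x ↦ kkt (H x) (Q x)` from those of `H`, `Q`), **`contDiffAt_flucCov_entry`**, **`contDiffAt_minOp_entry`**,
   **`contDiffAt_minOpL_entry`**, **`contDiffAt_effForm_entry`** (the four blocks of the bordered inverse are `C^k` in the background at a point where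
   `kkt (H x₀) (Q x₀)` is nonsingular).
Provenance: β sub-cell, unit beta-an2 gen 23 (prover-b2b-balaban-beta-an2-g23-0), 2026-08-20.  NOT (SDF), NOT D1, NOT `BetaPertH`, NOT continuum, NOT Clay.
-/

open Matrix Topology Filter
open scoped Matrix.Norms.Operator
open Literature.MathematicalPhysics.QuantumFieldTheory.Balaban1983to89.Beta.LogDetHessian (contDiffAt_matrix entryCLM entryCLM_apply)
open Literature.MathematicalPhysics.QuantumFieldTheory.Balaban1983to89.Beta.Composition (kkt)
open Literature.MathematicalPhysics.QuantumFieldTheory.Balaban1983to89.Beta.CompositionSingular (flucCov minOp minOpL effForm)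

namespace Summit.QuantumFields.BalabanUV.Beta.KKTInverseRegularity

variable {E : Type*} [NormedAddCommGroup E] [NormedSpace ℝ E]

/-! ## §1 Entries of the inverse of a `C^k` matrix field -/

section Inverse

variable {p : Type*} [Fintype p] [DecidableEq p]

/-- [folklore] **ENTRIES OF THE INVERSE ARE `C^k`**: if every entry of `K : E → Matrix p p ℝ` is `C^k` at `x₀` and `K x₀` is nonsingular, then every entry of
`x ↦ (K x)⁻¹` is `C^k` at `x₀` (matrix inversion is `Ring.inverse` on the complete normed algebra `Matrix p p ℝ`, analytic at units; entries are continuous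
linear functionals). -/
theorem contDiffAt_inv_entry {k : WithTop ℕ∞} {K : E → Matrix p p ℝ} {x₀ : E} (hK : ∀ i j, ContDiffAt ℝ k (fun x => K x i j) x₀)
    (h0 : IsUnit (K x₀).det) (i j : p) : ContDiffAt ℝ k (fun x => (K x)⁻¹ i j) x₀ := by
  haveI : CompleteSpace (Matrix p p ℝ) := FiniteDimensional.complete ℝ (Matrix p p ℝ)
  have hKm : ContDiffAt ℝ k K x₀ := contDiffAt_matrix hK
  obtain ⟨u, hu⟩ := (Matrix.isUnit_iff_isUnit_det (K x₀)).2 h0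
  have hri : ContDiffAt ℝ k (Ring.inverse : Matrix p p ℝ → Matrix p p ℝ) (K x₀) := by
    rw [← hu]; exact contDiffAt_ringInverse ℝ u
  have hcomp : ContDiffAt ℝ k (fun x => Ring.inverse (K x)) x₀ := hri.comp x₀ hKm
  have hentry : ContDiffAt ℝ k (fun x => entryCLM i j (Ring.inverse (K x))) x₀ :=
    (entryCLM i j).contDiff.contDiffAt.comp x₀ hcomp
  have hfun : (fun x => (K x)⁻¹ i j) = fun x => entryCLM i j (Ring.inverse (K x)) := by
    funext x; rw [entryCLM_apply, ← Matrix.nonsing_inv_eq_ringInverse]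
  rw [hfun]; exact hentry

end Inverse

/-! ## §2 The four blocks of the bordered inverse are `C^k` in the background -/

section Blocks

variable {ν μ : Type*} [Fintype ν] [Fintype μ] [DecidableEq ν] [DecidableEq μ]

omit [Fintype ν] [Fintype μ] [DecidableEq ν] [DecidableEq μ] in
/-- [folklore] Entries of the bordered matrix `kkt (H x) (Q x)` are `C^k` when those of `H` and `Q` are. -/
theorem contDiffAt_kkt_entry {k : WithTop ℕ∞} {H : E → Matrix ν ν ℝ} {Q : E → Matrix μ ν ℝ} {x₀ : E}
    (hH : ∀ a b, ContDiffAt ℝ k (fun x => H x a b) x₀) (hQ : ∀ a b, ContDiffAt ℝ k (fun x => Q x a b) x₀) :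
    ∀ a b, ContDiffAt ℝ k (fun x => kkt (H x) (Q x) a b) x₀ := by
  rintro (a | a) (b | b)
  · simpa [kkt] using hH a b
  · simpa [kkt] using hQ b a
  · simpa [kkt] using hQ a b
  · simpa [kkt] using (contDiffAt_const : ContDiffAt ℝ k (fun _ : E => (0 : ℝ)) x₀)

/-- [folklore] **THE FLUCTUATION COVARIANCE IS `C^k` IN THE BACKGROUND** at a point where the bordered matrix is nonsingular. -/
theorem contDiffAt_flucCov_entry {k : WithTop ℕ∞} {H : E → Matrix ν ν ℝ} {Q : E → Matrix μ ν ℝ} {x₀ : E}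
    (hH : ∀ a b, ContDiffAt ℝ k (fun x => H x a b) x₀) (hQ : ∀ a b, ContDiffAt ℝ k (fun x => Q x a b) x₀)
    (h0 : IsUnit (kkt (H x₀) (Q x₀)).det) (a b : ν) : ContDiffAt ℝ k (fun x => flucCov (H x) (Q x) a b) x₀ := by
  have h := contDiffAt_inv_entry (contDiffAt_kkt_entry hH hQ) h0 (Sum.inl a) (Sum.inl b)
  simpa [flucCov, Matrix.toBlocks₁₁] using h

/-- [folklore] **THE MINIMISER OPERATOR IS `C^k` IN THE BACKGROUND.** -/
theorem contDiffAt_minOp_entry {k : WithTop ℕ∞} {H : E → Matrix ν ν ℝ} {Q : E → Matrix μ ν ℝ} {x₀ : E}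
    (hH : ∀ a b, ContDiffAt ℝ k (fun x => H x a b) x₀) (hQ : ∀ a b, ContDiffAt ℝ k (fun x => Q x a b) x₀)
    (h0 : IsUnit (kkt (H x₀) (Q x₀)).det) (a : ν) (b : μ) : ContDiffAt ℝ k (fun x => minOp (H x) (Q x) a b) x₀ := by
  have h := contDiffAt_inv_entry (contDiffAt_kkt_entry hH hQ) h0 (Sum.inl a) (Sum.inr b)
  simpa [minOp, Matrix.toBlocks₁₂] using h

/-- [folklore] **THE LEFT COMPANION IS `C^k` IN THE BACKGROUND.** -/
theorem contDiffAt_minOpL_entry {k : WithTop ℕ∞} {H : E → Matrix ν ν ℝ} {Q : E → Matrix μ ν ℝ} {x₀ : E}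
    (hH : ∀ a b, ContDiffAt ℝ k (fun x => H x a b) x₀) (hQ : ∀ a b, ContDiffAt ℝ k (fun x => Q x a b) x₀)
    (h0 : IsUnit (kkt (H x₀) (Q x₀)).det) (a : μ) (b : ν) : ContDiffAt ℝ k (fun x => minOpL (H x) (Q x) a b) x₀ := by
  have h := contDiffAt_inv_entry (contDiffAt_kkt_entry hH hQ) h0 (Sum.inr a) (Sum.inl b)
  simpa [minOpL, Matrix.toBlocks₂₁] using h

/-- [folklore] **THE EFFECTIVE FORM IS `C^k` IN THE BACKGROUND** — in particular its physical corner `(effForm …).toBlocks₁₁`, the STEP family's form in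
K-U2d∕K-U2e, is `C^k` entrywise, so `FamilyRegularity.Family.contDiffAt_logZ` yields the `C²` hypothesis `hφ` of `PolarizationTelescopingCompSlice` from
primitive data. -/
theorem contDiffAt_effForm_entry {k : WithTop ℕ∞} {H : E → Matrix ν ν ℝ} {Q : E → Matrix μ ν ℝ} {x₀ : E}
    (hH : ∀ a b, ContDiffAt ℝ k (fun x => H x a b) x₀) (hQ : ∀ a b, ContDiffAt ℝ k (fun x => Q x a b) x₀)
    (h0 : IsUnit (kkt (H x₀) (Q x₀)).det) (a b : μ) : ContDiffAt ℝ k (fun x => effForm (H x) (Q x) a b) x₀ := by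
  have h := contDiffAt_inv_entry (contDiffAt_kkt_entry hH hQ) h0 (Sum.inr a) (Sum.inr b)
  simpa [effForm, Matrix.toBlocks₂₂] using h.neg

end Blocks

end Summit.QuantumFields.BalabanUV.Beta.KKTInverseRegularity
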